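import Literature.Analysis.FluidPDE.FracTransportHigher
import Literature.Analysis.UnboundedOperators.HeatKernelBoundedData
import Literature.Analysis.FunctionSpaces.ContDiffHolderAlgebra
import Mathlib.Analysis.SpecialFunctions.ImproperIntegrals
import Mathlib.Analysis.SpecialFunctions.Integrals.Basic
import HarnessLib

/-!
# The fractional Laplacian on Hölder spaces of the torus (De Rosa 2019, Thm. 7.1 =
# Roncal–Stinga 2016, Thm. 1.4)

L. De Rosa, *Infinitely many Leray–Hopf solutions for the fractional Navier–Stokes equations*,
Comm. PDE 44 (2019) 335–365 = arXiv:1801.10235, §7, **Thm. 7.1** ("Interaction with Hölder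
spaces"): "Let `γ, ε > 0` and `β ≥ 0` such that `2γ + β + ε ≤ 1`, and let `f : 𝕋³ → ℝ³`. If
`f ∈ C^{0,2γ+β+ε}`, then `(-Δ)^γ f ∈ C^β`, moreover there exists a constant `C = C(ε) > 0` such that
(7.1) `‖(-Δ)^γ f‖_β ≤ C(ε) [f]_{2γ+β+ε}`." Proof as printed: the case `β = 0` is Roncal–Stinga 2016,
Thm. 1.4; for `β > 0`, "`‖(-Δ)^γ(f(· + h) - f)‖₀ ≤ C(ε)[f(· + h) - f]_{2γ+ε} ≤ C(ε)|h|^β [f]_{2γ+β+ε}`,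
from which (7.1) follows". It is used throughout §5 of the paper to control the new dissipative
terms (proof of Prop. 5.3, (5.12): "`ν‖(-Δ)^γ(v_ℓ - vᵢ)‖_{N+α} ≲ ‖v_ℓ - vᵢ‖_{N+2γ+2α}`"; proof of
Prop. 5.4; Prop. 5.13 for `R̊^D_{q+1} = νℛ(-Δ)^γ w_{q+1}`).

This file **proves** the estimate for smooth fields (the only ones the scheme applies it to; the
tree's spectral `Torus.fracLaplacian` is meant for smooth fields), in every dimension, for
`0 < γ < 1`, with constants depending on `γ`, the exponents and `d`:

* `Torus.exists_norm_fracLaplacian_le_of_holder` — **the case `β = 0`**: for `2γ < θ ≤ 1` there is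
  `C` with `‖(-Δ)^γ u(x)‖ ≤ C A` whenever `‖u(y) - u(z)‖ ≤ A|y - z|^θ` (periodic lift). Proof by the
  heat-semigroup representation `I_γ (-Δ)^γ u(x) = ∫₀^∞ s^{-1-γ}(u(x) - e^{sΔ}u(x)) ds`
  (`Torus.integral_rpow_smul_sub_heatSmoothing`) and the two bounds
  `‖u(x) - e^{sΔ}u(x)‖ ≤ (1 + 2·2^{d/2}) A s^{θ/2}` (Gaussian moments,
  `UnboundedOperators.norm_heatExtension_sub_self_le_of_holder`) and `‖u(x) - e^{sΔ}u(x)‖ ≤ osc u ≤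
  A (2R₀)^θ` (periodicity), integrable against `s^{-1-γ}` exactly when `θ > 2γ`;
* `Torus.exists_norm_fracLaplacian_sub_le_of_holder` — **the case `β > 0`** by De Rosa's
  translation argument (`(-Δ)^γ` commutes with translations, `Torus.fracLaplacian_comp_add_right`,
  and `[u(· + h) - u]_θ ≤ 2|h|^β [u]_{θ+β}`);
* `Torus.exists_eContDiffHolderNorm_zero_fracLaplacian_le`,
  `Torus.exists_eContDiffHolderNorm_fracLaplacian_le` — **(7.1) in the accepted norms**: for
  `ℝ≥0` exponents with `2γ + β < s ≤ 1` and every `N` there is `C` with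
  `‖(-Δ)^γ u‖_{N,β} ≤ C ‖u‖_{N,s}` for all smooth `u` (`Torus.eContDiffHolderNorm`; the level `N`
  by `∂ₖ(-Δ)^γ = (-Δ)^γ∂ₖ`, `Torus.partialDeriv_fracLaplacian_comm`).

## References

* L. De Rosa, Comm. PDE 44 (2019) 335–365 = arXiv:1801.10235, §7 Thm. 7.1 and its proof
  (p. 19 of the arXiv text); §5.2 proof of Prop. 5.3 ((5.12)), Prop. 5.13. [`Derosa2018`]
* L. Roncal, P. R. Stinga, *Fractional Laplacian on the torus*, Commun. Contemp. Math. 18 (2016),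
  Thm. 1.4 (the case `β = 0`, via the semigroup/subordination formula). [`RoncalStinga2016`]
-/

noncomputable section

open MeasureTheory Set Filter Metric Function UnitAddTorus
open Literature.Analysis.UnboundedOperators
open scoped NNReal ENNReal ContDiff Topology

namespace Literature.Analysis.FluidPDE

namespace Torus

open FunctionSpaces FunctionSpaces.Torus

variable {d : Type*} [Fintype d] [DecidableEq d]

/-! ## Oscillation and heat-smoothing errors of Hölder fields -/

section Smoothing

omit [DecidableEq d] in
/-- **Oscillation of a periodic Hölder field**: if `‖u(proj y) - u(proj z)‖ ≤ A‖y - z‖^θ` and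
`‖repr w‖ ≤ R₀` for all `w`, then `‖u a - u b‖ ≤ A (2R₀)^θ` for all `a, b ∈ T^d`. [folklore] -/
theorem norm_sub_le_of_holder_lift {Y : Type*} [NormedAddCommGroup Y] {u : UnitAddTorus d → Y}
    {R₀ : ℝ} (hR₀ : ∀ w : UnitAddTorus d, ‖repr w‖ ≤ R₀) {A θ : ℝ} (hA : 0 ≤ A) (hθ : 0 ≤ θ)
    (hH : ∀ y z : EuclideanSpace ℝ d, ‖u (proj y) - u (proj z)‖ ≤ A * ‖y - z‖ ^ θ)
    (a b : UnitAddTorus d) : ‖u a - u b‖ ≤ A * (2 * R₀) ^ θ := by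
  have h := hH (repr a) (repr b)
  rw [proj_repr, proj_repr] at h
  refine h.trans (mul_le_mul_of_nonneg_left (Real.rpow_le_rpow (norm_nonneg _) ?_ hθ) hA)
  calc ‖repr a - repr b‖ ≤ ‖repr a‖ + ‖repr b‖ := norm_sub_le _ _
    _ ≤ R₀ + R₀ := add_le_add (hR₀ a) (hR₀ b)
    _ = 2 * R₀ := by ring

omit [DecidableEq d] in
/-- **Heat smoothing moves a field by at most its oscillation**: if `‖u a - u b‖ ≤ M` for all
`a, b` then `‖u(x) - e^{sΔ}u(x)‖ ≤ M` (`G_s ≥ 0`, `∫ G_s = 1`). [folklore] -/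
theorem norm_sub_heatSmoothing_le_of_osc {u : UnitAddTorus d → EuclideanSpace ℝ d} (hu : Continuous u)
    {M : ℝ} (hM : ∀ a b, ‖u a - u b‖ ≤ M) {s : ℝ} (hs : 0 < s) (x : UnitAddTorus d) :
    ‖u x - ∫ z : EuclideanSpace ℝ d, heatKernel s z • u (x - proj z)‖ ≤ M := by
  have hint := integrable_heatKernel_smul_comp hu hs x
  have hK := integrable_heatKernel_holds (E := EuclideanSpace ℝ d) hs
  have h1 : u x - ∫ z : EuclideanSpace ℝ d, heatKernel s z • u (x - proj z) =
      ∫ z : EuclideanSpace ℝ d, heatKernel s z • (u x - u (x - proj z)) := by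
    simp_rw [smul_sub]
    rw [integral_sub (hK.smul_const _) hint, integral_smul_const, integral_heatKernel_eq_one_holds hs,
      one_smul]
  rw [h1]
  have hM0 : 0 ≤ M := (norm_nonneg _).trans (hM x x)
  refine (norm_integral_le_of_norm_le (hK.mul_const M) (Eventually.of_forall fun z => ?_)).trans ?_
  · rw [norm_smul, Real.norm_of_nonneg (heatKernel_pos hs z).le]
    exact mul_le_mul_of_nonneg_left (hM _ _) (heatKernel_pos hs z).le
  · rw [integral_mul_const, integral_heatKernel_eq_one_holds hs, one_mul]

omit [DecidableEq d] in
/-- **Heat smoothing error for Hölder fields on the torus**: if `‖u(proj y) - u(proj z)‖ ≤ A‖y - z‖^θ`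
(`0 ≤ θ ≤ 1`) then `‖u(x) - e^{sΔ}u(x)‖ ≤ (1 + 2·2^{d/2}) A s^{θ/2}` (the Gaussian moment bound
`UnboundedOperators.norm_heatExtension_sub_self_le_of_holder` applied to the periodic lift). [folklore] -/
theorem norm_sub_heatSmoothing_le_of_holder {u : UnitAddTorus d → EuclideanSpace ℝ d} (hu : Continuous u)
    {A θ : ℝ} (hA : 0 ≤ A) (hθ0 : 0 ≤ θ) (hθ1 : θ ≤ 1)
    (hH : ∀ y z : EuclideanSpace ℝ d, ‖u (proj y) - u (proj z)‖ ≤ A * ‖y - z‖ ^ θ)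
    {s : ℝ} (hs : 0 < s) (x : UnitAddTorus d) :
    ‖u x - ∫ z : EuclideanSpace ℝ d, heatKernel s z • u (x - proj z)‖ ≤
      (1 + 2 * (2 : ℝ) ^ ((Fintype.card d : ℝ) / 2)) * A * s ^ (θ / 2) := by
  obtain ⟨y, rfl⟩ := proj_surjective x
  obtain ⟨C, hC⟩ := (isCompact_univ.image hu).isBounded.exists_norm_le
  have hC' : ∀ z, ‖lift u z‖ ≤ C := fun z => hC _ (mem_image_of_mem u (mem_univ _))
  have hcont : Continuous (lift u) := continuous_lift_iff.2 hu
  have hH' : ∀ y' z' : EuclideanSpace ℝ d, ‖lift u y' - lift u z'‖ ≤ A * ‖y' - z'‖ ^ θ := fun y' z' =>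
    hH y' z'
  have h := norm_heatExtension_sub_self_le_of_holder hcont hC' hA hθ0 hθ1 hH' hs y
  rw [heatExtension_apply, finrank_euclideanSpace, Fintype.card] at h
  have heq : ∫ z : EuclideanSpace ℝ d, heatKernel s z • u (proj y - proj z) =
      ∫ z : EuclideanSpace ℝ d, heatKernel s z • lift u (y - z) := by
    refine integral_congr_ae (Eventually.of_forall fun z => ?_)
    simp only [lift_apply, proj_sub]
  rw [heq, norm_sub_rev]
  simpa [lift_apply] using h

end Smoothing

/-! ## Thm. 7.1, the case `β = 0`: a sup bound by a Hölder seminorm above `2γ` -/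

section SupBound

/-- **`‖(-Δ)^γ u‖₀ ≲ [u]_θ` for `θ > 2γ`** (De Rosa Thm. 7.1 with `β = 0` = Roncal–Stinga 2016,
Thm. 1.4, for smooth fields): for `0 < γ < 1` and `2γ < θ ≤ 1` there is `C = C(γ, θ, d)` such that
for every smooth `u : T^d → ℝ^d` with `‖u(proj y) - u(proj z)‖ ≤ A‖y - z‖^θ`:
`‖(-Δ)^γ u(x)‖ ≤ C A` for all `x`. [cite: Derosa2018, §7 Thm. 7.1] -/
theorem exists_norm_fracLaplacian_le_of_holder (d : Type*) [Fintype d] [DecidableEq d]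
    {γ : ℝ} (hγ0 : 0 < γ) (hγ1 : γ < 1) {θ : ℝ} (hθ : 2 * γ < θ) (hθ1 : θ ≤ 1) :
    ∃ C : ℝ, 0 ≤ C ∧ ∀ {u : UnitAddTorus d → EuclideanSpace ℝ d}, IsSmooth u → ∀ {A : ℝ}, 0 ≤ A →
      (∀ y z : EuclideanSpace ℝ d, ‖u (proj y) - u (proj z)‖ ≤ A * ‖y - z‖ ^ θ) →
      ∀ x, ‖fracLaplacian γ u x‖ ≤ C * A := by
  obtain ⟨R₀, hR₀pos, hR₀⟩ := exists_norm_repr_le d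
  set K : ℝ := 1 + 2 * (2 : ℝ) ^ ((Fintype.card d : ℝ) / 2) with hK
  have hK0 : 0 ≤ K := by positivity
  set I : ℝ := ∫ t in Ioi (0 : ℝ), t ^ (-1 - γ) * (1 - Real.exp (-t)) with hI
  have hI0 : 0 < I := momentConst_pos hγ0 hγ1
  set e : ℝ := θ / 2 - γ with he
  have he0 : 0 < e := by rw [he]; linarith
  have hθ0 : 0 ≤ θ := by linarith
  set D : ℝ := (2 * R₀) ^ θ with hD
  have hD0 : 0 ≤ D := Real.rpow_nonneg (by linarith) _
  refine ⟨I⁻¹ * (K / e + D / γ), by positivity, ?_⟩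
  intro u hu A hA hH x
  obtain ⟨hint, heq⟩ := integral_rpow_smul_sub_heatSmoothing hγ0 hγ1 hu x
  set F : ℝ → EuclideanSpace ℝ d := fun s => s ^ (-1 - γ) •
    (u x - ∫ z : EuclideanSpace ℝ d, heatKernel s z • u (x - proj z)) with hF
  -- the two bounds for the smoothing error
  have hosc : ∀ a b, ‖u a - u b‖ ≤ A * D := norm_sub_le_of_holder_lift hR₀ hA hθ0 hH
  have hb1 : ∀ s, 0 < s → ‖u x - ∫ z : EuclideanSpace ℝ d, heatKernel s z • u (x - proj z)‖ ≤
      K * A * s ^ (θ / 2) := fun s hs =>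
    norm_sub_heatSmoothing_le_of_holder hu.continuous hA hθ0 hθ1 hH hs x
  have hb2 : ∀ s, 0 < s → ‖u x - ∫ z : EuclideanSpace ℝ d, heatKernel s z • u (x - proj z)‖ ≤ A * D :=
    fun s hs => norm_sub_heatSmoothing_le_of_osc hu.continuous hosc hs x
  -- the majorant
  set m : ℝ → ℝ := fun s => if s ≤ 1 then K * A * s ^ (e - 1) else A * D * s ^ (-1 - γ) with hm
  have hFm : ∀ s ∈ Ioi (0 : ℝ), ‖F s‖ ≤ m s := by
    intro s hs
    have hs' : 0 < s := hs
    rw [hF]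
    dsimp only
    rw [norm_smul, Real.norm_of_nonneg (Real.rpow_nonneg hs'.le _), hm]
    dsimp only
    split_ifs with h1
    · calc s ^ (-1 - γ) * ‖u x - ∫ z : EuclideanSpace ℝ d, heatKernel s z • u (x - proj z)‖
          ≤ s ^ (-1 - γ) * (K * A * s ^ (θ / 2)) :=
            mul_le_mul_of_nonneg_left (hb1 s hs') (Real.rpow_nonneg hs'.le _)
        _ = K * A * (s ^ (-1 - γ) * s ^ (θ / 2)) := by ring
        _ = K * A * s ^ (e - 1) := by
            rw [← Real.rpow_add hs']
            congr 2
            rw [he]; ring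
    · calc s ^ (-1 - γ) * ‖u x - ∫ z : EuclideanSpace ℝ d, heatKernel s z • u (x - proj z)‖
          ≤ s ^ (-1 - γ) * (A * D) := mul_le_mul_of_nonneg_left (hb2 s hs') (Real.rpow_nonneg hs'.le _)
        _ = A * D * s ^ (-1 - γ) := by ring
  -- integrability and the value of the majorant's integral
  have hm1 : IntegrableOn m (Ioc 0 1) := by
    have h : IntegrableOn (fun s : ℝ => K * A * s ^ (e - 1)) (Ioc 0 1) :=
      ((intervalIntegrable_iff_integrableOn_Ioc_of_le zero_le_one).1
        (intervalIntegral.intervalIntegrable_rpow' (by linarith : -1 < e - 1))).const_mul (K * A)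
    refine h.congr_fun (fun s hs => ?_) measurableSet_Ioc
    rw [hm]; dsimp only; rw [if_pos hs.2]
  have hm2 : IntegrableOn m (Ioi 1) := by
    have h : IntegrableOn (fun s : ℝ => A * D * s ^ (-1 - γ)) (Ioi 1) :=
      (integrableOn_Ioi_rpow_of_lt (by linarith : -1 - γ < -1) one_pos).const_mul (A * D)
    refine h.congr_fun (fun s hs => ?_) measurableSet_Ioi
    have hs' : ¬ s ≤ 1 := not_le.2 hs
    rw [hm]; dsimp only; rw [if_neg hs']
  have hmint : IntegrableOn m (Ioi 0) := by
    rw [← Ioc_union_Ioi_eq_Ioi zero_le_one]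
    exact hm1.union hm2
  have hval1 : ∫ s in Ioc 0 1, m s = K * A * (1 / e) := by
    have h1 : ∫ s in Ioc 0 1, m s = ∫ s in Ioc 0 1, K * A * s ^ (e - 1) :=
      setIntegral_congr_fun measurableSet_Ioc fun s hs => by rw [hm]; dsimp only; rw [if_pos hs.2]
    rw [h1, ← intervalIntegral.integral_of_le zero_le_one, intervalIntegral.integral_const_mul,
      integral_rpow (Or.inl (by linarith : -1 < e - 1))]
    congr 1
    rw [show e - 1 + 1 = e by ring, Real.one_rpow, Real.zero_rpow he0.ne']
    ring
  have hval2 : ∫ s in Ioi 1, m s = A * D * (1 / γ) := by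
    have h1 : ∫ s in Ioi 1, m s = ∫ s in Ioi 1, A * D * s ^ (-1 - γ) :=
      setIntegral_congr_fun measurableSet_Ioi fun s hs => by
        have hs' : ¬ s ≤ 1 := not_le.2 hs
        rw [hm]; dsimp only; rw [if_neg hs']
    rw [h1, integral_const_mul, integral_Ioi_rpow_of_lt (by linarith : -1 - γ < -1) one_pos]
    congr 1
    rw [show -1 - γ + 1 = -γ by ring, Real.one_rpow]
    field_simp
  have hval : ∫ s in Ioi 0, m s = K * A * (1 / e) + A * D * (1 / γ) := by
    rw [← Ioc_union_Ioi_eq_Ioi zero_le_one, setIntegral_union (Ioc_disjoint_Ioi le_rfl)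
      measurableSet_Ioi hm1 hm2, hval1, hval2]
  -- conclude
  have hnorm : ‖∫ s in Ioi 0, F s‖ ≤ K * A * (1 / e) + A * D * (1 / γ) := by
    rw [← hval]
    refine norm_integral_le_of_norm_le hmint ?_
    filter_upwards [ae_restrict_mem measurableSet_Ioi] with s hs
    exact hFm s hs
  rw [heq, norm_smul, Real.norm_of_nonneg hI0.le] at hnorm
  calc ‖fracLaplacian γ u x‖ = I⁻¹ * (I * ‖fracLaplacian γ u x‖) := by
        rw [← mul_assoc, inv_mul_cancel₀ hI0.ne', one_mul]
    _ ≤ I⁻¹ * (K * A * (1 / e) + A * D * (1 / γ)) :=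
        mul_le_mul_of_nonneg_left hnorm (inv_nonneg.2 hI0.le)
    _ = I⁻¹ * (K / e + D / γ) * A := by ring

end SupBound

/-! ## Thm. 7.1, the case `β > 0`: translations -/

section HolderBound

omit [DecidableEq d] in
/-- **Increments of a Hölder field are Hölder with a gain**: if `‖u(proj y) - u(proj z)‖ ≤ A‖y - z‖^{θ+β}`
(`θ, β ≥ 0`), then `φ = u(· + proj h) - u` satisfies `‖φ(proj y) - φ(proj z)‖ ≤ 2A‖h‖^β ‖y - z‖^θ`
(De Rosa: "`[f(· + h) - f]_{2γ+ε} ≤ |h|^β [f]_{2γ+β+ε}`"). [cite: Derosa2018, §7 Thm. 7.1 (proof)] -/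
theorem norm_increment_sub_le_of_holder {Y : Type*} [NormedAddCommGroup Y] {u : UnitAddTorus d → Y}
    {A θ β : ℝ} (hA : 0 ≤ A) (hθ : 0 ≤ θ) (hβ : 0 ≤ β)
    (hH : ∀ y z : EuclideanSpace ℝ d, ‖u (proj y) - u (proj z)‖ ≤ A * ‖y - z‖ ^ (θ + β))
    (h y z : EuclideanSpace ℝ d) :
    ‖(u (proj y + proj h) - u (proj y)) - (u (proj z + proj h) - u (proj z))‖ ≤
      2 * A * ‖h‖ ^ β * ‖y - z‖ ^ θ := by
  have hyz := norm_nonneg (y - z)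
  have hh := norm_nonneg h
  -- bound (a): by the distance `‖y - z‖`
  have ha : ‖(u (proj y + proj h) - u (proj y)) - (u (proj z + proj h) - u (proj z))‖ ≤
      2 * A * ‖y - z‖ ^ (θ + β) := by
    have h1 := hH (y + h) (z + h)
    rw [proj_add, proj_add, show y + h - (z + h) = y - z by abel] at h1
    have h2 := hH y z
    calc ‖(u (proj y + proj h) - u (proj y)) - (u (proj z + proj h) - u (proj z))‖
        = ‖(u (proj y + proj h) - u (proj z + proj h)) - (u (proj y) - u (proj z))‖ := by
          congr 1; abel
      _ ≤ ‖u (proj y + proj h) - u (proj z + proj h)‖ + ‖u (proj y) - u (proj z)‖ := norm_sub_le _ _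
      _ ≤ A * ‖y - z‖ ^ (θ + β) + A * ‖y - z‖ ^ (θ + β) := add_le_add h1 h2
      _ = 2 * A * ‖y - z‖ ^ (θ + β) := by ring
  -- bound (b): by the shift `‖h‖`
  have hb : ‖(u (proj y + proj h) - u (proj y)) - (u (proj z + proj h) - u (proj z))‖ ≤
      2 * A * ‖h‖ ^ (θ + β) := by
    have h1 := hH (y + h) y
    rw [proj_add, add_sub_cancel_left] at h1
    have h2 := hH (z + h) z
    rw [proj_add, add_sub_cancel_left] at h2
    calc ‖(u (proj y + proj h) - u (proj y)) - (u (proj z + proj h) - u (proj z))‖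
        ≤ ‖u (proj y + proj h) - u (proj y)‖ + ‖u (proj z + proj h) - u (proj z)‖ := norm_sub_le _ _
      _ ≤ A * ‖h‖ ^ (θ + β) + A * ‖h‖ ^ (θ + β) := add_le_add h1 h2
      _ = 2 * A * ‖h‖ ^ (θ + β) := by ring
  rcases le_or_gt ‖h‖ ‖y - z‖ with hle | hlt
  · refine hb.trans ?_
    rw [add_comm θ β, Real.rpow_add_of_nonneg hh hβ hθ, ← mul_assoc]
    exact mul_le_mul_of_nonneg_left (Real.rpow_le_rpow hh hle hθ) (by positivity)
  · refine ha.trans ?_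
    rw [add_comm θ β, Real.rpow_add_of_nonneg hyz hβ hθ, ← mul_assoc]
    refine mul_le_mul_of_nonneg_right ?_ (Real.rpow_nonneg hyz _)
    exact mul_le_mul_of_nonneg_left (Real.rpow_le_rpow hyz hlt.le hβ) (by positivity)

/-- **`[(-Δ)^γ u]_β ≲ [u]_{θ+β}` for `θ > 2γ`** (De Rosa Thm. 7.1, the case `β > 0`, for smooth
fields): for `0 < γ < 1`, `0 ≤ β`, `2γ < θ` with `θ + β ≤ 1` there is `C` such that for every smooth
`u : T^d → ℝ^d` with `‖u(proj y) - u(proj z)‖ ≤ A‖y - z‖^{θ+β}`: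
`‖(-Δ)^γ u(proj y₁) - (-Δ)^γ u(proj y₂)‖ ≤ C A ‖y₁ - y₂‖^β` ("`‖(-Δ)^γ(f(· + h) - f)‖₀ ≤
C(ε)[f(· + h) - f]_{2γ+ε} ≤ C(ε)|h|^β [f]_{2γ+β+ε}`"). [cite: Derosa2018, §7 Thm. 7.1] -/
theorem exists_norm_fracLaplacian_sub_le_of_holder (d : Type*) [Fintype d] [DecidableEq d]
    {γ : ℝ} (hγ0 : 0 < γ) (hγ1 : γ < 1) {θ β : ℝ} (hβ : 0 ≤ β) (hθ : 2 * γ < θ) (hθβ : θ + β ≤ 1) :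
    ∃ C : ℝ, 0 ≤ C ∧ ∀ {u : UnitAddTorus d → EuclideanSpace ℝ d}, IsSmooth u → ∀ {A : ℝ}, 0 ≤ A →
      (∀ y z : EuclideanSpace ℝ d, ‖u (proj y) - u (proj z)‖ ≤ A * ‖y - z‖ ^ (θ + β)) →
      ∀ y₁ y₂ : EuclideanSpace ℝ d,
        ‖fracLaplacian γ u (proj y₁) - fracLaplacian γ u (proj y₂)‖ ≤ C * A * ‖y₁ - y₂‖ ^ β := by
  have hθ0 : 0 ≤ θ := by linarith
  obtain ⟨C₁, hC₁0, hC₁⟩ := exists_norm_fracLaplacian_le_of_holder d hγ0 hγ1 hθ (by linarith)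
  refine ⟨2 * C₁, by positivity, ?_⟩
  intro u hu A hA hH y₁ y₂
  set h : EuclideanSpace ℝ d := y₁ - y₂ with hh
  set φ : UnitAddTorus d → EuclideanSpace ℝ d := fun x => u (x + proj h) - u x with hφ
  have hT : IsSmooth (fun x => u (x + proj h)) := hu.comp_add_right _
  have hφs : IsSmooth φ := hT.sub hu
  have hφH : ∀ y z : EuclideanSpace ℝ d, ‖φ (proj y) - φ (proj z)‖ ≤ (2 * A * ‖h‖ ^ β) * ‖y - z‖ ^ θ :=
    fun y z => norm_increment_sub_le_of_holder hA hθ0 hβ hH h y z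
  have hb := hC₁ hφs (by positivity : 0 ≤ 2 * A * ‖h‖ ^ β) hφH (proj y₂)
  have hΛ : fracLaplacian γ φ (proj y₂) = fracLaplacian γ u (proj y₁) - fracLaplacian γ u (proj y₂) := by
    rw [hφ, fracLaplacian_sub hγ0.le hT hu, fracLaplacian_comp_add_right]
    dsimp only
    rw [← proj_add, hh, add_sub_cancel]
  rw [hΛ] at hb
  calc ‖fracLaplacian γ u (proj y₁) - fracLaplacian γ u (proj y₂)‖ ≤ C₁ * (2 * A * ‖h‖ ^ β) := hb
    _ = 2 * C₁ * A * ‖y₁ - y₂‖ ^ β := by rw [hh]; ring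

end HolderBound

/-! ## (7.1) in the `C^{N,β}` norms -/

section Norms

/-- **De Rosa Thm. 7.1 in `C^{0,β}`**: for `0 < γ < 1` and `ℝ≥0` exponents with `2γ + β < s ≤ 1`
there is `C` with `‖(-Δ)^γ u‖_{0,β} ≤ C ‖u‖_{0,s}` for every smooth `u : T^d → ℝ^d` (the accepted
norms `Torus.eContDiffHolderNorm 0 r = ‖·‖_∞ + [·]_r` of the lift; in fact only the seminorm
`[u]_s` enters). [cite: Derosa2018, §7 Thm. 7.1 (7.1)] -/
theorem exists_eContDiffHolderNorm_zero_fracLaplacian_le (d : Type) [Fintype d] [DecidableEq d]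
    {γ : ℝ} (hγ0 : 0 < γ) (hγ1 : γ < 1) {β s : ℝ≥0} (hs : 2 * γ + β < s) (hs1 : s ≤ 1) :
    ∃ C : ℝ≥0, ∀ {u : UnitAddTorus d → EuclideanSpace ℝ d}, IsSmooth u →
      Torus.eContDiffHolderNorm 0 β (fracLaplacian γ u) ≤ C * Torus.eContDiffHolderNorm 0 s u := by
  have hβ0 : (0 : ℝ) ≤ β := β.2
  have hs1' : (s : ℝ) ≤ 1 := by exact_mod_cast hs1
  have hθ : 2 * γ < (s : ℝ) - β := by linarith
  obtain ⟨C₁, hC₁0, hC₁⟩ := exists_norm_fracLaplacian_le_of_holder d hγ0 hγ1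
    (θ := (s : ℝ)) (by linarith) hs1'
  obtain ⟨C₂, hC₂0, hC₂⟩ := exists_norm_fracLaplacian_sub_le_of_holder d hγ0 hγ1 hβ0 hθ (by linarith)
  refine ⟨(C₁ + C₂).toNNReal, fun {u} hu => ?_⟩
  have hsplit : ∀ (φ : UnitAddTorus d → EuclideanSpace ℝ d) (r : ℝ≥0), Torus.eContDiffHolderNorm 0 r φ =
      eSupNorm φ + eHolderNorm r (lift φ) := fun φ r => by
    rw [Torus.eContDiffHolderNorm, eContDiffHolderNorm_zero_eq, eSupNorm_lift]
  set Hs := eHolderNorm s (lift u) with hHs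
  -- the seminorm of a smooth field is finite
  have hfin : Torus.eContDiffHolderNorm 0 s u ≠ ⊤ := (hu.eContDiffHolderNorm_lt_top 0 hs1).ne
  have hT : Hs ≠ ⊤ := ne_top_of_le_ne_top hfin (by rw [hsplit]; exact le_add_self)
  -- the real Hölder constant
  set A : ℝ := Hs.toReal with hA
  have hA0 : 0 ≤ A := ENNReal.toReal_nonneg
  have hH : ∀ y z : EuclideanSpace ℝ d, ‖u (proj y) - u (proj z)‖ ≤ A * ‖y - z‖ ^ (s : ℝ) :=
    fun y z => norm_sub_le_of_eHolderNorm_le (φ := lift u) hA0 (by rw [hA, ENNReal.ofReal_toReal hT]) y z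
  have h1 : eSupNorm (fracLaplacian γ u) ≤ ENNReal.ofReal (C₁ * A) :=
    eSupNorm_le_ofReal fun x => hC₁ hu hA0 hH x
  have hH' : ∀ y z : EuclideanSpace ℝ d, ‖u (proj y) - u (proj z)‖ ≤ A * ‖y - z‖ ^ (((s : ℝ) - β) + β) := by
    simpa using hH
  have h2 : eHolderNorm β (lift (fracLaplacian γ u)) ≤ ENNReal.ofReal (C₂ * A) :=
    eHolderNorm_le_ofReal_of_norm_sub_le (φ := lift (fracLaplacian γ u)) (mul_nonneg hC₂0 hA0)
      fun y₁ y₂ => hC₂ hu hA0 hH' y₁ y₂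
  rw [hsplit]
  calc eSupNorm (fracLaplacian γ u) + eHolderNorm β (lift (fracLaplacian γ u))
      ≤ ENNReal.ofReal (C₁ * A) + ENNReal.ofReal (C₂ * A) := add_le_add h1 h2
    _ = ENNReal.ofReal (C₁ + C₂) * Hs := by
        rw [← ENNReal.ofReal_add (mul_nonneg hC₁0 hA0) (mul_nonneg hC₂0 hA0), ← add_mul,
          ENNReal.ofReal_mul (add_nonneg hC₁0 hC₂0), hA, ENNReal.ofReal_toReal hT]
    _ ≤ ENNReal.ofReal (C₁ + C₂) * Torus.eContDiffHolderNorm 0 s u := by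
        refine mul_le_mul' le_rfl ?_
        rw [hsplit]
        exact le_add_self

/-- `‖u‖_{0,s} ≤ 3^N ‖u‖_{N,s}` for smooth `u` and `s ≤ 1` (iterating
`Torus.eContDiffHolderNorm_le_three_mul_succ`). [folklore] -/
theorem eContDiffHolderNorm_zero_le_pow_mul {d : Type} [Fintype d] {Y : Type*} [NormedAddCommGroup Y]
    [NormedSpace ℝ Y] {u : UnitAddTorus d → Y} (hu : IsSmooth u) {s : ℝ≥0} (hs1 : s ≤ 1) (N : ℕ) :
    Torus.eContDiffHolderNorm 0 s u ≤ 3 ^ N * Torus.eContDiffHolderNorm N s u := by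
  induction N with
  | zero => simp
  | succ N IH =>
    have h := Torus.eContDiffHolderNorm_le_three_mul_succ (k := N) (r := s)
      (hu.isContDiff (n := (N + 1 : ℕ)) (by exact_mod_cast le_top)) hs1 s
    calc Torus.eContDiffHolderNorm 0 s u ≤ 3 ^ N * Torus.eContDiffHolderNorm N s u := IH
      _ ≤ 3 ^ N * (3 * Torus.eContDiffHolderNorm (N + 1) s u) := mul_le_mul' le_rfl h
      _ = 3 ^ (N + 1) * Torus.eContDiffHolderNorm (N + 1) s u := by rw [pow_succ]; ring

/-- **De Rosa Thm. 7.1 in `C^{N,β}`** ("`‖(-Δ)^γ f‖_β ≤ C(ε)[f]_{2γ+β+ε}`", all orders, as used in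
(5.12): "`ν‖(-Δ)^γ(v_ℓ - vᵢ)‖_{N+α} ≲ ‖v_ℓ - vᵢ‖_{N+2γ+2α}`"): for `0 < γ < 1`, `ℝ≥0` exponents with
`2γ + β < s ≤ 1` and every `N` there is `C = C(γ, β, s, N, d)` with
`‖(-Δ)^γ u‖_{N,β} ≤ C ‖u‖_{N,s}` for every smooth `u : T^d → ℝ^d` (induction on `N` through
`∂ₖ(-Δ)^γ u = (-Δ)^γ ∂ₖu`, `Torus.partialDeriv_fracLaplacian_comm`).
[cite: Derosa2018, §7 Thm. 7.1 (7.1); §5.2 (5.12)] -/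
theorem exists_eContDiffHolderNorm_fracLaplacian_le (d : Type) [Fintype d] [DecidableEq d]
    {γ : ℝ} (hγ0 : 0 < γ) (hγ1 : γ < 1) {β s : ℝ≥0} (hs : 2 * γ + β < s) (hs1 : s ≤ 1) (N : ℕ) :
    ∃ C : ℝ≥0, ∀ {u : UnitAddTorus d → EuclideanSpace ℝ d}, IsSmooth u →
      Torus.eContDiffHolderNorm N β (fracLaplacian γ u) ≤ C * Torus.eContDiffHolderNorm N s u := by
  classical
  obtain ⟨C₀, hC₀⟩ := exists_eContDiffHolderNorm_zero_fracLaplacian_le d hγ0 hγ1 hs hs1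
  induction N with
  | zero => exact ⟨C₀, fun hu => hC₀ hu⟩
  | succ N IH =>
    obtain ⟨CN, hCN⟩ := IH
    refine ⟨C₀ * 3 ^ (N + 1) + Fintype.card d * CN, fun {u} hu => ?_⟩
    have hΛ : IsSmooth (fracLaplacian γ u) := hu.fracLaplacian hγ0.le
    have h1 : eSupNorm (fracLaplacian γ u) ≤ C₀ * (3 ^ (N + 1) * Torus.eContDiffHolderNorm (N + 1) s u) :=
      calc eSupNorm (fracLaplacian γ u) ≤ Torus.eContDiffHolderNorm 0 β (fracLaplacian γ u) :=
            Torus.eSupNorm_le_eContDiffHolderNorm 0 β _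
        _ ≤ C₀ * Torus.eContDiffHolderNorm 0 s u := hC₀ hu
        _ ≤ C₀ * (3 ^ (N + 1) * Torus.eContDiffHolderNorm (N + 1) s u) :=
            mul_le_mul' le_rfl (eContDiffHolderNorm_zero_le_pow_mul hu hs1 (N + 1))
    have h2 : ∀ k, Torus.eContDiffHolderNorm N β (FunctionSpaces.Torus.partialDeriv k (fracLaplacian γ u)) ≤
        CN * Torus.eContDiffHolderNorm (N + 1) s u := by
      intro k
      rw [partialDeriv_fracLaplacian_comm hγ0.le hu k]
      refine (hCN (hu.partialDeriv k)).trans (mul_le_mul' le_rfl ?_)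
      exact Torus.eContDiffHolderNorm_partialDeriv_le (hu.isContDiff (n := (N + 1 : ℕ))
        (by exact_mod_cast le_top)) k s
    calc Torus.eContDiffHolderNorm (N + 1) β (fracLaplacian γ u)
        ≤ eSupNorm (fracLaplacian γ u) + ∑ k, Torus.eContDiffHolderNorm N β (FunctionSpaces.Torus.partialDeriv k (fracLaplacian γ u)) :=
          BDSV.eContDiffHolderNorm_succ_le_sum hΛ N β
      _ ≤ C₀ * (3 ^ (N + 1) * Torus.eContDiffHolderNorm (N + 1) s u) +
            ∑ _k : d, CN * Torus.eContDiffHolderNorm (N + 1) s u :=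
          add_le_add h1 (Finset.sum_le_sum fun k _ => h2 k)
      _ = ((C₀ * 3 ^ (N + 1) + Fintype.card d * CN : ℝ≥0) : ℝ≥0∞) * Torus.eContDiffHolderNorm (N + 1) s u := by
          rw [Finset.sum_const, Finset.card_univ, nsmul_eq_mul]
          push_cast
          ring

end Norms

end Torus

end Literature.Analysis.FluidPDE
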